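import Mathlib
import HarnessLib

/-!
# The frozen-exterior (quenched) penalty of a restricted-kernel switching protocol

HONEST FRAMING: exact (Metropolis-corrected) sampling algorithms for lattice gauge theory;
figures of merit are autocorrelation/cost numbers at stated couplings and volumes; no
continuum-physics claim.

Venture `LatticeQCDFlow` (cell pub-lqcd), topic `Exactness`; FANOUT row 13 (`eng-snf`, the
`latflow.snf` protocol engine, release 0.1.6 `snf.eqscan`).  NEW WORK of the cell (two applications
of Jensen's inequality for `exp` on finite weighted sums), not a published result; nothing is cited
as a fact.  Companions in this topic: `LocalUpdates.lean` (masked / frozen-block kernels keep the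
Gibbs weight stationary, so Jarzynski's identity holds per frozen exterior), `JarzynskiFinite.lean`,
`QuasiStaticDissipation.lean` (the per-step-equilibrium floor of the kernel part).

## Content

A non-equilibrium switching protocol whose relaxation kernel updates only a BALL around the defect
(`latflow.snf` lever `protocol.sweep_region = defect-ball`, radius `r`) leaves the exterior `y` of
the ball frozen at the value it had in the prior sample.  Conditionally on `y` everything is an
ordinary protocol on the ball with conditional free-energy difference `ΔF(y)`, and the prior
marginal of `y` has weights `p y`.  Two elementary facts, typed here for a finite exterior alphabet
`Y` and finite path spaces:

* `annealedDeltaF p ΔF = −log Σ_y p_y e^{−ΔF y}` is the free-energy difference the MIXTURE estimates: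
  if every exterior obeys Jarzynski, `Σ_ω q_{y,ω} e^{−W_{y,ω}} = e^{−ΔF y}`, then the mixture obeys
  `Σ_y p_y Σ_ω q_{y,ω} e^{−W_{y,ω}} = e^{−annealedDeltaF}` (`mixture_jarzynski`) — the frozen exterior
  costs NO exactness;
* but it costs dissipation: the QUENCHED mean `Σ_y p_y ΔF y` exceeds the annealed value
  (`annealedDeltaF_le_quenchedMean`, Jensen for `exp`), the gap
  `frozenExteriorPenalty p ΔF = Σ_y p_y ΔF y − annealedDeltaF ≥ 0` vanishes iff `ΔF` is constant on
  the support of `p` (`frozenExteriorPenalty_eq_zero_iff`), and the mean work of ANY frozen-exterior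
  protocol — however many steps, whatever the kernel inside the ball — satisfies
  `Σ_y p_y ⟨W⟩_y − annealedDeltaF ≥ frozenExteriorPenalty` (`penalty_le_meanWork_sub_annealed`), because
  each exterior separately obeys the second law `ΔF y ≤ ⟨W⟩_y` (`deltaF_le_meanWork_of_jarzynski`).

So `⟨W⟩ − ΔF ≥ Q` for every `n_step`: the part of the dissipation that only a larger ball (or an
exterior update inside the evolution) removes.  The engine measures `Q` as (quenched thermodynamic
integration) − (Jarzynski ΔF); at SU(3) β 6.0, L_d 2 it found Q(r) = 8.0(5) / 0.29(15) / 0.01(12)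
nats for r = 0 / 1 / 2 (HOME/eng-snf/evidence/eqscan-su3-Q-of-r-hublocal.md; toy volumes).
-/

namespace Summit.Ventures.LatticeQCDFlow.Exactness

open Finset Real

variable {Y : Type*} [Fintype Y]

section FrozenExteriorPenalty

/-- The QUENCHED mean free-energy difference `Σ_y p_y ΔF(y)`: the average over frozen exteriors
`y` (prior weights `p`) of the conditional free-energy difference of the ball. -/
def quenchedMean (p dF : Y → ℝ) : ℝ := ∑ y, p y * dF y

/-- The ANNEALED free-energy difference `−log Σ_y p_y e^{−ΔF(y)}` — the quantity the mixture of
frozen-exterior evolutions estimates by Jarzynski (`mixture_jarzynski`); for the defect protocol it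
is the true `F_target − F_prior` because `Σ_y p_y Z₁(y)/Z₀(y) = Z₁/Z₀` when `p_y = Z₀(y)/Z₀`. -/
noncomputable def annealedDeltaF (p dF : Y → ℝ) : ℝ := -Real.log (∑ y, p y * Real.exp (-dF y))

/-- The frozen-exterior (quenched) penalty `Q = Σ_y p_y ΔF(y) − annealedDeltaF p ΔF`. -/
noncomputable def frozenExteriorPenalty (p dF : Y → ℝ) : ℝ :=
  quenchedMean p dF - annealedDeltaF p dF

/-- Jensen for `exp` on the finite mixture: `e^{−Σ p ΔF} ≤ Σ_y p_y e^{−ΔF(y)}` for probability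
weights `p`. -/
theorem exp_neg_quenchedMean_le {p dF : Y → ℝ} (hp : ∀ y, 0 ≤ p y) (hsum : ∑ y, p y = 1) :
    Real.exp (-quenchedMean p dF) ≤ ∑ y, p y * Real.exp (-dF y) := by
  have h := (convexOn_exp).map_sum_le (t := Finset.univ) (w := p) (p := fun y => -dF y)
    (fun y _ => hp y) hsum (fun y _ => Set.mem_univ _)
  have h1 : ∑ y, p y • (-dF y) = -quenchedMean p dF := by
    simp only [quenchedMean, smul_eq_mul, mul_neg, Finset.sum_neg_distrib]
  have h2 : ∑ y, p y • Real.exp (-dF y) = ∑ y, p y * Real.exp (-dF y) := by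
    simp only [smul_eq_mul]
  rw [h1, h2] at h
  exact h

/-- The mixture partition sum `Σ_y p_y e^{−ΔF(y)}` is positive for probability weights. -/
theorem mixtureSum_pos {p dF : Y → ℝ} (hp : ∀ y, 0 ≤ p y) (hsum : ∑ y, p y = 1) :
    0 < ∑ y, p y * Real.exp (-dF y) :=
  lt_of_lt_of_le (Real.exp_pos _) (exp_neg_quenchedMean_le hp hsum)

/-- QUENCHED ≥ ANNEALED: `−log Σ_y p_y e^{−ΔF(y)} ≤ Σ_y p_y ΔF(y)` (Jensen). -/
theorem annealedDeltaF_le_quenchedMean {p dF : Y → ℝ} (hp : ∀ y, 0 ≤ p y)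
    (hsum : ∑ y, p y = 1) : annealedDeltaF p dF ≤ quenchedMean p dF := by
  have hpos := mixtureSum_pos (dF := dF) hp hsum
  have h := exp_neg_quenchedMean_le (dF := dF) hp hsum
  have hlog : -quenchedMean p dF ≤ Real.log (∑ y, p y * Real.exp (-dF y)) := by
    have := Real.log_le_log (Real.exp_pos _) h
    rwa [Real.log_exp] at this
  unfold annealedDeltaF
  linarith

/-- The frozen-exterior penalty is non-negative. -/
theorem frozenExteriorPenalty_nonneg {p dF : Y → ℝ} (hp : ∀ y, 0 ≤ p y) (hsum : ∑ y, p y = 1) :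
    0 ≤ frozenExteriorPenalty p dF := by
  unfold frozenExteriorPenalty
  linarith [annealedDeltaF_le_quenchedMean (dF := dF) hp hsum]

/-- EQUALITY CASE: the penalty vanishes iff `ΔF` is constant on the support of `p` (strict
convexity of `exp`).  In words: the restricted kernel is free of the quenched penalty exactly when
the conditional free-energy difference of the ball does not depend on the frozen exterior. -/
theorem frozenExteriorPenalty_eq_zero_iff {p dF : Y → ℝ} (hp : ∀ y, 0 ≤ p y)
    (hsum : ∑ y, p y = 1) :
    frozenExteriorPenalty p dF = 0 ↔
      ∀ ⦃y⦄, p y ≠ 0 → ∀ ⦃y'⦄, p y' ≠ 0 → dF y = dF y' := by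
  have hpos := mixtureSum_pos (dF := dF) hp hsum
  -- the penalty is zero iff Jensen is an equality
  have key : frozenExteriorPenalty p dF = 0 ↔
      Real.exp (∑ y, p y • (-dF y)) = ∑ y, p y • Real.exp (-dF y) := by
    have h1 : ∑ y, p y • (-dF y) = -quenchedMean p dF := by
      simp only [quenchedMean, smul_eq_mul, mul_neg, Finset.sum_neg_distrib]
    have h2 : ∑ y, p y • Real.exp (-dF y) = ∑ y, p y * Real.exp (-dF y) := by
      simp only [smul_eq_mul]
    rw [h1, h2]
    constructor
    · intro h0
      have hq : quenchedMean p dF = annealedDeltaF p dF := by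
        unfold frozenExteriorPenalty at h0; linarith
      rw [hq]
      unfold annealedDeltaF
      rw [neg_neg, Real.exp_log hpos]
    · intro heq
      unfold frozenExteriorPenalty annealedDeltaF
      rw [← heq, Real.log_exp]
      ring
  rw [key]
  have hj := (strictConvexOn_exp).map_sum_eq_iff_of_nonneg (t := Finset.univ) (w := p)
    (p := fun y => -dF y) (fun y _ => hp y) hsum (fun y _ => Set.mem_univ _)
  rw [hj]
  constructor
  · intro h y hy y' hy'
    have := h (Finset.mem_univ y) hy (Finset.mem_univ y') hy'
    simpa using this
  · intro h y _ hy y' _ hy'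
    have := h hy hy'
    simpa using this

/-- JARZYNSKI SURVIVES THE FROZEN EXTERIOR.  If every exterior `y` obeys the Jarzynski identity on
its (finite) path space — path probabilities `q y ω`, works `W y ω`, `Σ_ω q_{y,ω} e^{−W_{y,ω}} =
e^{−ΔF(y)}` — then the mixture over exteriors with weights `p` obeys it with the ANNEALED free-energy
difference: `Σ_y p_y Σ_ω q_{y,ω} e^{−W_{y,ω}} = e^{−annealedDeltaF p ΔF}`. -/
theorem mixture_jarzynski {Ω : Type*} [Fintype Ω] {p dF : Y → ℝ} {q W : Y → Ω → ℝ}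
    (hp : ∀ y, 0 ≤ p y) (hsum : ∑ y, p y = 1)
    (hJ : ∀ y, ∑ ω, q y ω * Real.exp (-W y ω) = Real.exp (-dF y)) :
    ∑ y, p y * ∑ ω, q y ω * Real.exp (-W y ω) = Real.exp (-annealedDeltaF p dF) := by
  have hpos := mixtureSum_pos (dF := dF) hp hsum
  unfold annealedDeltaF
  rw [neg_neg, Real.exp_log hpos]
  exact Finset.sum_congr rfl fun y _ => by rw [hJ y]

/-- THE SECOND LAW PER EXTERIOR: a finite path law `q ≥ 0`, `Σ q = 1` obeying Jarzynski
`Σ_ω q_ω e^{−W_ω} = e^{−ΔF}` has `ΔF ≤ Σ_ω q_ω W_ω` (Jensen for `exp`). -/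
theorem deltaF_le_meanWork_of_jarzynski {Ω : Type*} [Fintype Ω] {q W : Ω → ℝ} {dF : ℝ}
    (hq : ∀ ω, 0 ≤ q ω) (hqs : ∑ ω, q ω = 1)
    (hJ : ∑ ω, q ω * Real.exp (-W ω) = Real.exp (-dF)) : dF ≤ ∑ ω, q ω * W ω := by
  have h := (convexOn_exp).map_sum_le (t := Finset.univ) (w := q) (p := fun ω => -W ω)
    (fun ω _ => hq ω) hqs (fun ω _ => Set.mem_univ _)
  have h1 : ∑ ω, q ω • (-W ω) = -∑ ω, q ω * W ω := by
    simp only [smul_eq_mul, mul_neg, Finset.sum_neg_distrib]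
  have h2 : ∑ ω, q ω • Real.exp (-W ω) = ∑ ω, q ω * Real.exp (-W ω) := by
    simp only [smul_eq_mul]
  rw [h1, h2, hJ] at h
  have := Real.exp_le_exp.mp h
  linarith

/-- THE FROZEN-EXTERIOR PENALTY BOUNDS THE DISSIPATION FROM BELOW, FOR EVERY NUMBER OF STEPS.  With
per-exterior Jarzynski as in `mixture_jarzynski` and `q y ≥ 0`, `Σ_ω q y ω = 1`, the mixture's mean
work minus the annealed free-energy difference is at least `frozenExteriorPenalty p ΔF` (which is
itself `≥ 0`, `frozenExteriorPenalty_nonneg`): `Q ≤ Σ_y p_y Σ_ω q_{y,ω} W_{y,ω} − annealedDeltaF`.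
Nothing about the number of protocol steps or the kernel inside the ball enters — only that the
exterior is not updated. -/
theorem penalty_le_meanWork_sub_annealed {Ω : Type*} [Fintype Ω] {p dF : Y → ℝ}
    {q W : Y → Ω → ℝ} (hp : ∀ y, 0 ≤ p y)
    (hq : ∀ y ω, 0 ≤ q y ω) (hqs : ∀ y, ∑ ω, q y ω = 1)
    (hJ : ∀ y, ∑ ω, q y ω * Real.exp (-W y ω) = Real.exp (-dF y)) :
    frozenExteriorPenalty p dF ≤ (∑ y, p y * ∑ ω, q y ω * W y ω) - annealedDeltaF p dF := by
  have hle : quenchedMean p dF ≤ ∑ y, p y * ∑ ω, q y ω * W y ω := by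
    unfold quenchedMean
    exact Finset.sum_le_sum fun y _ =>
      mul_le_mul_of_nonneg_left (deltaF_le_meanWork_of_jarzynski (hq y) (hqs y) (hJ y)) (hp y)
  unfold frozenExteriorPenalty
  linarith

/-- Corollary in the form the engine quotes: mean work ≥ annealed ΔF + Q ≥ annealed ΔF, i.e. the
dissipation `⟨W⟩ − ΔF` of a frozen-exterior protocol is at least the quenched penalty. -/
theorem annealed_add_penalty_le_meanWork {Ω : Type*} [Fintype Ω] {p dF : Y → ℝ}
    {q W : Y → Ω → ℝ} (hp : ∀ y, 0 ≤ p y)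
    (hq : ∀ y ω, 0 ≤ q y ω) (hqs : ∀ y, ∑ ω, q y ω = 1)
    (hJ : ∀ y, ∑ ω, q y ω * Real.exp (-W y ω) = Real.exp (-dF y)) :
    annealedDeltaF p dF + frozenExteriorPenalty p dF ≤ ∑ y, p y * ∑ ω, q y ω * W y ω := by
  linarith [penalty_le_meanWork_sub_annealed (W := W) hp hq hqs hJ]

end FrozenExteriorPenalty

end Summit.Ventures.LatticeQCDFlow.Exactness
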